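import Literature.AlgebraicGeometry.Motives.HodgeThetaAnnihilatorRankThreeTimesAbelian
import Literature.AlgebraicGeometry.HodgeTheory.RealSl2BlocksTimesCMInvariance
import Literature.AlgebraicGeometry.HodgeTheory.Sl2IsotypicLetters
import HarnessLib

/-!
# Hodge classes on abelian varieties with slots over `A × C`, `A` non-CM of Hodge-group rank three and `C` of CM type:
# the invariance theorem — the coefficient tensor is killed by `𝔰𝔩₂` placed at ALL `A`-positions (Lombardo 2016 Lemma 3.4 /
# Moonen–Zarhin 1999 (3.1)–(3.2)(2), Lie step; Murty 1984 / Gordon §7.3.2)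

Family `hodge`, layer `Literature/AlgebraicGeometry/HodgeTheory`.  Written for the cell `pub-hodgecm2` (COR-CM), seat `b27`,
count-neutral lane MT-RANK-FIVE-HODGE (the Hodge side of the Mumford–Tate rank ladder rung `dim MT(H¹X) = 5`, non-CM;
sequel of MT-RANK-FOUR-DIVISORS `Sl2Isotypic*` and MT-RANK-FIVE).  UNCONDITIONAL Hodge theory of complex abelian varieties
(`hHD`, `hI` are the tree theorems `exists_isReal_hodgeModel_holds`, `hodgePQ_independent_of_hodgeModel_holds`, kept as
arguments as in the whole Betti universe); theorems only, no definition, no named fact (D-0026); no use of HC_CM and no step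
towards a summit statement.  It is the `𝔰𝔩₂`-ISOTYPIC twin of the tree's `AVSlots.exists_coeff_killed_at_real_places_of_prod_cmType`
(`RealSl2BlocksTimesCMInvariance`, cell `pub-hodge-ring2`, `A` with REAL `𝔰𝔩₂`-blocks), whose presentation lemmas
(`exists_basis_of_presentation`, `toMatrix_eq_blockLift_of_apply_basis`, `exists_hodgeAdapted_pairBasis`) it reuses BY NAME.

PRINTED RESULT.  Lombardo 2016, Lemma 3.4 (p. 1229): «Suppose `B` is of CM type and `A_K̄` has no simple factor of type IV.
Then `H(A × B) ≅ H(A) × H(B)`»; Moonen–Zarhin 1999 §3 (3.1)–(3.2)(2): then the Hodge ring of every `A^m × B^n` is generated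
by the classes coming from the factors.  HERE: `A` NOT of CM type with `dim_ℚ Lie Hg(H¹A) ≤ 3` (Moonen–Zarhin Types I(1)
`Hg = SL₂` / II(1) `Hg = SL₁(D)`: non-CM elliptic curves, abelian surfaces with quaternionic multiplication; Gordon §7.3.2),
`C` of CM type (`Milne1999.IsOfCMType`), `X` with a slot structure `g` over `A × C` (e.g. `(A × C)^{N+1}`), in the tree's
word model, with the abstract Lie step `HodgeStructure.wordDerAt_eq_zero_of_rankThree_times_abelian`.

MAIN RESULT `AVSlots.exists_coeff_killed_at_isotypic_places_of_prod_cmType`.  LETTERS of `X`: `g_j^* pr_A^* b_τ^r` (`b` the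
PAIR BASIS of `H¹(A) ⊗ ℂ`, `b_τ^0 = e τ ∈ H^{1,0}`, `b_τ^1 = F(e τ) ∈ H^{0,1}`, places `τ ∈ T = {σ // deg σ = 1}`;
`HodgeStructure.exists_pairBasis`) and `g_j^* pr_C^* c_i^r` (`(c_i^0, c_i^1)_i` a Hodge-adapted pair basis of `H¹(C) ⊗ ℂ`,
places `i ∈ Fin h`).  Every rational `(p,p)`-class on `X` (`p ≥ 1`) is `∑_w a(w) · (letters)_w` for a coefficient function `a`
on words in the letters `((j, t), r)`, `t ∈ T ⊕ Fin h`, such that along every slot-and-place word `U` the raising operator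
`E₀₁` and `h = diag(1, −1)`, each placed SIMULTANEOUSLY at all positions of `A`-places and `0` at the `C`-places, kill the
slice `a(U, −)` — `Lie Hg(A) ⊗ ℂ ≅ 𝔰𝔩₂` acts isotypically on the pair blocks (`HodgeStructure.pairBasis_actions`) and the
`C`-places carry NO condition («`H(B)` is a torus»).  PROOF = the template's, with the Lie step fed with Riemann
(`unop_bettiRep_mem_endAlg`) and the CM commutant (`IsOfCMType.exists_commutant_comm`), transported back for `Y₀ ∈ {α⁻¹E, Θ′}`.

## References
* [Lombardo2016] D. Lombardo, Ann. Inst. Fourier 66 (2016), Lemma 3.4 (p. 1229). [cite: Lombardo2016, Lemma 3.4 (p. 1229)]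
* [MoonenZarhin1999LowDim] B. Moonen, Yu. Zarhin, Math. Ann. 315 (1999), §2, §3 (3.1)–(3.2). [cite: MoonenZarhin1999LowDim, §3 (3.1)–(3.2)]
* [Gordon1997] B. B. Gordon, App. B of Lewis (1999) = arXiv:alg-geom/9709030, §7.3.2, Thm. 7.5. [cite: Gordon1997, §7.3.2 and Thm. 7.5]
* [Deligne1982HodgeCycles] P. Deligne, LNM 900 (1982), I §3 Prop. 3.4. [cite: Deligne1982HodgeCycles, I §3 Prop. 3.4]
* [GoodmanWallachGTM255] R. Goodman, N. R. Wallach, GTM 255, §4.1.1. [cite: GoodmanWallachGTM255, §4.1.1]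
-/

noncomputable section

open scoped TensorProduct
open CategoryTheory Module

namespace Literature.AlgebraicGeometry.HodgeTheory

open Literature.AlgebraicTopology.SingularHomology
open Literature.AlgebraicGeometry.Motives
open Literature.Barriers.HodgeConjecture
open Literature.AlgebraicGeometry.Motives.HodgeStructure
open Literature.AlgebraicGeometry.ComplexMultiplication
open Literature.RepresentationTheory.GeneralLinear
open Literature.NumberTheory.DiophantineGeometry

/-! ### §1 A word-model lemma: a place-family of blocks placed in all slots -/

section WordModel

variable {K : Type*} {J T : Type*} {N d : ℕ}

/-- **A place-family of blocks placed in all slots kills all slices ⟹ the family read along the places of a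
slot-and-place word kills the refined slices** (the general form of the tree's `wordDerAt_colourOp_placeRefine_eq_zero`,
which is the case `Nf = δ_τ N`). [cite: GoodmanWallachGTM255, §4.1.1] -/
theorem wordDerAt_placeFamily_placeRefine_eq_zero [Field K] [Fintype T] [DecidableEq T] (φ : Fin N ≃ T × Fin 2)
    {a : (Fin d → J × Fin N) → K} (Nf : T → Matrix (Fin 2) (Fin 2) K)
    (h : ∀ u : Fin d → J, wordDerAt K (fun _ : Fin d => blockLift φ Nf) (wordSlice a u) = 0)
    (U : Fin d → J × T) :
    wordDerAt K (fun t => Nf (U t).2) (wordSlice (placeRefine φ a) U) = 0 := by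
  funext η
  set ε : Word N d := fun t => φ.symm ((U t).2, η t) with hε
  have h1 := congrFun (h fun t => (U t).1) ε
  rw [wordDerAt_blockLift_wordSlice] at h1
  have hU : (fun t => ((U t).1, (φ (ε t)).1)) = U := funext fun t => by
    rw [hε, Equiv.apply_symm_apply]
  have hη : (fun t => (φ (ε t)).2) = η := funext fun t => by rw [hε, Equiv.apply_symm_apply]
  have hfam : (fun t => Nf (φ (ε t)).1) = fun t => Nf (U t).2 := funext fun t => by
    rw [hε, Equiv.apply_symm_apply]
  rw [hU, hη, hfam] at h1
  rw [h1, Pi.zero_apply, Pi.zero_apply]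

end WordModel

/-! ### §2 The invariance theorem for slots over `A × C`, `A` of Hodge-group rank three -/

section Invariance

variable {A C X : AbelianVariety ℂ} {n : ℕ} {g : Fin n → (X ⟶ A.prod C)}

open scoped Classical in
/-- **The INVARIANCE THEOREM for slots over `A × C`, `A` NOT of CM type with `dim Lie Hg(H¹A) ≤ 3`, `C` of CM type
(Lombardo 2016 Lemma 3.4 / Moonen–Zarhin 1999 (3.1)–(3.2)(2), Lie step; Murty 1984).**  With `ψ`, a graded basis `e`,
`X₀ ∈ Lie Hg ∖ End_Hdg`, `dim_ℚ Lie Hg ≤ 3` and the pair basis `b` of `H¹(A) ⊗ ℂ`, `C` of CM type and `X` with slots `g` over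
`A × C`: there is a Hodge-adapted pair basis `cC` of `H¹(C) ⊗ ℂ` such that every rational `(p,p)`-class on `X` (`p ≥ 1`) has a
coefficient function in the two-sorted letters whose slices along slot-and-place words are killed by `E₀₁` and by `diag(1,−1)`
placed at ALL `A`-positions (`0` at the `C`-positions). [cite: Lombardo2016, Lemma 3.4 (p. 1229)]
[cite: MoonenZarhin1999LowDim, §3 (3.1)–(3.2)] [cite: Gordon1997, §7.3.2 and Thm. 7.5] -/
theorem AVSlots.exists_coeff_killed_at_isotypic_places_of_prod_cmType [HodgeTensorFacts.{0, 0}]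
    (hg : AVSlots (A.prod C) X g)
    (hHD : exists_isReal_hodgeModel) (hI : hodgePQ_independent_of_hodgeModel)
    (ψ : (BettiUniverse.hodge hHD (AbelianVariety.isSmoothProjective_holds (A := A)) 1).Polarization)
    {S : Type} [Fintype S] [DecidableEq S] {deg : S → ℤ}
    (e : Module.Basis S ℂ (ℂ ⊗[ℚ] bettiCohomology A.X 1))
    (hF : ∀ a, (BettiUniverse.hodge hHD (AbelianVariety.isSmoothProjective_holds (A := A)) 1).F a =
      Submodule.span ℂ (e '' {σ | a ≤ deg σ}))
    (hFc : ∀ a, complexConj ((BettiUniverse.hodge hHD (AbelianVariety.isSmoothProjective_holds (A := A)) 1).F a) =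
      Submodule.span ℂ (e '' {σ | deg σ ≤ 1 - a}))
    {X₀ : Module.End ℚ (bettiCohomology A.X 1)}
    (hX₀ : X₀ ∈ (BettiUniverse.hodge hHD (AbelianVariety.isSmoothProjective_holds (A := A)) 1).hodgeLie)
    (hX₀E : X₀ ∉ (BettiUniverse.hodge hHD (AbelianVariety.isSmoothProjective_holds (A := A)) 1).endAlg)
    (h3 : Module.finrank ℚ
      (BettiUniverse.hodge hHD (AbelianVariety.isSmoothProjective_holds (A := A)) 1).hodgeLie ≤ 3)
    (b : Module.Basis ({σ : S // deg σ = 1} × Fin 2) ℂ (ℂ ⊗[ℚ] bettiCohomology A.X 1))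
    (hb0 : ∀ τ, b (τ, 0) = e τ)
    (hb1 : ∀ τ, b (τ, 1) = ((1 - gradingEnd e deg) * X₀.baseChange ℂ * gradingEnd e deg) (e τ))
    (hC : Milne1999.IsOfCMType C) :
    ∃ (h : ℕ) (cC : Module.Basis (Fin h × Fin 2) ℂ (ℂ ⊗[ℚ] bettiCohomology C.X 1)),
      (∀ i, cC (i, 0) ∈ (BettiUniverse.hodge hHD (AbelianVariety.isSmoothProjective_holds (A := C)) 1).piece 1 0) ∧
      (∀ i, cC (i, 1) ∈ (BettiUniverse.hodge hHD (AbelianVariety.isSmoothProjective_holds (A := C)) 1).piece 0 1) ∧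
      ∀ {p : ℕ}, 0 < p → ∀ {c : complexBetti X.X (2 * p)}, IsRationalClass c →
        IsOfHodgeType X.dim X.X (2 * p) p p c →
        ∃ a : (Fin (2 * p) → (Fin n × ({σ : S // deg σ = 1} ⊕ Fin h)) × Fin 2) → ℂ,
          wordEval (cupPowOneAlt ℂ (Motives.ComplexPoints X.X) (2 * p))
            (fun jr : (Fin n × ({σ : S // deg σ = 1} ⊕ Fin h)) × Fin 2 => complexBetti.map (g jr.1.1).hom.hom.hom 1
              (Sum.elim
                (fun τ => complexBetti.map (Motives.AbelianVariety.fst A C).hom.hom.hom 1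
                  (ofRatClassBaseChange (Motives.ComplexPoints A.X) 1 (b (τ, jr.2))))
                (fun i => complexBetti.map (Motives.AbelianVariety.snd A C).hom.hom.hom 1
                  (ofRatClassBaseChange (Motives.ComplexPoints C.X) 1 (cC (i, jr.2))))
                jr.1.2)) a = c ∧
          ∀ U : Fin (2 * p) → Fin n × ({σ : S // deg σ = 1} ⊕ Fin h),
            wordDerAt ℂ (fun t => Sum.elim (fun _ => Matrix.single 0 1 (1 : ℂ)) (fun _ => (0 : Matrix (Fin 2) (Fin 2) ℂ))
              (U t).2) (wordSlice a U) = 0 ∧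
            wordDerAt ℂ (fun t => Sum.elim (fun _ => Matrix.diagonal ![(1 : ℂ), -1])
              (fun _ => (0 : Matrix (Fin 2) (Fin 2) ℂ)) (U t).2) (wordSlice a U) = 0 := by
  classical
  -- the setting
  have hXA : IsSmoothProjective A.dim A.X := AbelianVariety.isSmoothProjective_holds
  have hXC : IsSmoothProjective C.dim C.X := AbelianVariety.isSmoothProjective_holds
  have hXP : IsSmoothProjective (A.prod C).dim (A.prod C).X := AbelianVariety.isSmoothProjective_holds
  haveI : Module.Finite ℚ (bettiCohomology A.X 1) := finite_bettiCohomology_one A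
  haveI : Module.Finite ℚ (bettiCohomology C.X 1) := finite_bettiCohomology_one C
  haveI : Module.Finite ℚ (bettiCohomology (A.prod C).X 1) := finite_bettiCohomology_one (A.prod C)
  set H := BettiUniverse.hodge hHD hXA 1 with hHdef
  have hH : H.IsEffective := BettiUniverse.hodge_isEffective hHD hXA 1
  have hne : ¬ H.hodgeLie ≤ Subalgebra.toSubmodule H.endAlg := fun hle => hX₀E (hle hX₀)
  have hdeg : ∀ σ, deg σ = 0 ∨ deg σ = 1 := fun σ => by
    have h := hH.deg_mem_Icc_of_graded e hF hFc σ
    omega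
  -- the triple and its action on the pair basis
  obtain ⟨α, hα, hEb, -, hΘ'b⟩ := HodgeStructure.pairBasis_actions H ψ rfl hH e hF hFc hX₀ hX₀E h3 b hb0 hb1
  set P := gradingEnd e deg with hP
  set E := P * X₀.baseChange ℂ * (1 - P) with hEdef
  set F := (1 - P) * X₀.baseChange ℂ * P with hFdef
  set Θ' : Module.End ℂ (ℂ ⊗[ℚ] bettiCohomology A.X 1) := (2 : ℂ) • P - 1 with hΘ'def
  obtain ⟨hEM, -⟩ := projE_mem_hodgeLieC H e hF hFc hdeg (H.baseChange_mem_hodgeLieC hX₀)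
  rw [← hP, ← hEdef] at hEM
  have hΘ'M : Θ' ∈ H.hodgeLieC := by
    have h := two_smul_gradingEnd_sub_mem_hodgeLieC H e hF hFc
    rwa [show (2 : ℂ) • gradingEnd e deg - ((((1 : ℕ) : ℤ) : ℤ) : ℂ) • (1 : Module.End ℂ (ℂ ⊗[ℚ] bettiCohomology A.X 1))
        = Θ' by rw [hΘ'def, hP]; norm_num] at h
  -- Hodge types of the pair basis
  have hb0piece : ∀ τ : {σ : S // deg σ = 1}, b (τ, 0) ∈ H.piece 1 0 := fun τ => by
    have h := basis_mem_piece_of_graded H e hF hFc τ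
    rw [τ.2] at h; rw [hb0]; simpa using h
  have hb1piece : ∀ τ : {σ : S // deg σ = 1}, b (τ, 1) ∈ H.piece 0 1 := fun τ => by
    have h : F (e τ) ∈ H.piece 0 (((1 : ℕ) : ℤ) - 0) := by
      rw [piece_eq_span_of_graded H e hF hFc 0, hFdef, Module.End.mul_apply, Module.End.mul_apply]
      exact one_sub_gradingEnd_apply_mem_span_zero e hdeg _
    rw [hb1]; simpa using h
  -- §2 of the template: the pair basis of `H¹(C) ⊗ ℂ`
  obtain ⟨h, cC, hcC0, hcC1⟩ := exists_hodgeAdapted_pairBasis (BettiUniverse.hodge hHD hXC 1) (by norm_num)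
    (BettiUniverse.hodge_isEffective hHD hXC 1)
  have hcC0' : ∀ i, cC (i, 0) ∈ (BettiUniverse.hodge hHD hXC 1).piece 1 0 := fun i => by simpa using hcC0 i
  refine ⟨h, cC, hcC0', fun i => by simpa using hcC1 i, fun {p} hp {c} hcQ hc => ?_⟩
  -- the presentation `H¹(A × C) = pr_A^* H¹(A) ⊕ pr_C^* H¹(C)` and its complexification
  set ι₁ := HOneProduct.pullFst A C with hι₁
  set π₁ := HOneProduct.pullInl A C with hπ₁
  set ι₂ := HOneProduct.pullSnd A C with hι₂
  set π₂ := HOneProduct.pullInr A C with hπ₂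
  have hπι₁ : π₁ ∘ₗ ι₁ = LinearMap.id := HOneProduct.pullInl_comp_pullFst
  have hπι₂ : π₂ ∘ₗ ι₂ = LinearMap.id := HOneProduct.pullInr_comp_pullSnd
  have hπ₁ι₂ : π₁ ∘ₗ ι₂ = 0 := HOneProduct.pullInl_comp_pullSnd
  have hπ₂ι₁ : π₂ ∘ₗ ι₁ = 0 := HOneProduct.pullInr_comp_pullFst
  have hsum : ι₁ ∘ₗ π₁ + ι₂ ∘ₗ π₂ = LinearMap.id := HOneProduct.pullFst_comp_pullInl_add
  have hπι₁C : π₁.baseChange ℂ ∘ₗ ι₁.baseChange ℂ = LinearMap.id := by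
    rw [← LinearMap.baseChange_comp, hπι₁, LinearMap.baseChange_id]
  have hπι₂C : π₂.baseChange ℂ ∘ₗ ι₂.baseChange ℂ = LinearMap.id := by
    rw [← LinearMap.baseChange_comp, hπι₂, LinearMap.baseChange_id]
  have hπ₁ι₂C : π₁.baseChange ℂ ∘ₗ ι₂.baseChange ℂ = 0 := by rw [← LinearMap.baseChange_comp, hπ₁ι₂, LinearMap.baseChange_zero]
  have hπ₂ι₁C : π₂.baseChange ℂ ∘ₗ ι₁.baseChange ℂ = 0 := by rw [← LinearMap.baseChange_comp, hπ₂ι₁, LinearMap.baseChange_zero]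
  have hsumC : ι₁.baseChange ℂ ∘ₗ π₁.baseChange ℂ + ι₂.baseChange ℂ ∘ₗ π₂.baseChange ℂ = LinearMap.id := by
    rw [← LinearMap.baseChange_comp, ← LinearMap.baseChange_comp, ← LinearMap.baseChange_add, hsum, LinearMap.baseChange_id]
  -- piece compatibility of `pr_A^*`, `pr_C^*` (pull-backs are morphisms of Hodge structures)
  have hι₁F : ∀ q : ℤ, ∀ x ∈ (BettiUniverse.hodge hHD hXA 1).piece q (((1 : ℕ) : ℤ) - q),
      ι₁.baseChange ℂ x ∈ (BettiUniverse.hodge hHD hXP 1).piece q (((1 : ℕ) : ℤ) - q) :=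
    fun q x hx => (BettiUniverse.pullHodgeHom hHD hI hXP hXA (Motives.AbelianVariety.fst A C).hom.hom.hom 1).map_piece_le
      q _ ⟨x, hx, rfl⟩
  have hι₂F : ∀ q : ℤ, ∀ x ∈ (BettiUniverse.hodge hHD hXC 1).piece q (((1 : ℕ) : ℤ) - q),
      ι₂.baseChange ℂ x ∈ (BettiUniverse.hodge hHD hXP 1).piece q (((1 : ℕ) : ℤ) - q) :=
    fun q x hx => (BettiUniverse.pullHodgeHom hHD hI hXP hXC (Motives.AbelianVariety.snd A C).hom.hom.hom 1).map_piece_le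
      q _ ⟨x, hx, rfl⟩
  -- §1: the basis `cbx` of `H¹(A × C) ⊗ ℂ` in blocks: `pr_A^* b_τ^r` and `pr_C^* c_i^r`
  obtain ⟨cbx', hcbx'l, hcbx'r⟩ := exists_basis_of_presentation hπι₁C hπι₂C hπ₁ι₂C hπ₂ι₁C hsumC b cC
  set cbx : Module.Basis (({σ : S // deg σ = 1} ⊕ Fin h) × Fin 2) ℂ (ℂ ⊗[ℚ] bettiCohomology (A.prod C).X 1) :=
    cbx'.reindex (Equiv.sumProdDistrib {σ : S // deg σ = 1} (Fin h) (Fin 2)).symm with hcbxdef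
  have hcbx : ∀ tr : ({σ : S // deg σ = 1} ⊕ Fin h) × Fin 2, cbx tr =
      Sum.elim (fun τ => ι₁.baseChange ℂ (b (τ, tr.2))) (fun i => ι₂.baseChange ℂ (cC (i, tr.2))) tr.1 := by
    rintro ⟨t, r⟩
    rw [hcbxdef, Module.Basis.reindex_apply, Equiv.symm_symm]
    rcases t with τ | i
    · rw [Equiv.sumProdDistrib_apply_left, hcbx'l]; rfl
    · rw [Equiv.sumProdDistrib_apply_right, hcbx'r]; rfl
  -- Hodge-adaptedness of `cbx`
  have hcbx0 : ∀ t, cbx (t, 0) ∈ (BettiUniverse.hodge hHD hXP 1).piece 1 0 := fun t => by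
    rw [hcbx]; rcases t with τ | i
    · exact hι₁F 1 _ (by simpa using hb0piece τ)
    · exact hι₂F 1 _ (by simpa using hcC0' i)
  have hcbx1 : ∀ t, cbx (t, 1) ∈ (BettiUniverse.hodge hHD hXP 1).piece 0 1 := fun t => by
    have e01 : (((1 : ℕ) : ℤ) - 0) = 1 := by norm_num
    rw [hcbx]; rcases t with τ | i
    · have h01 := hι₁F 0 _ (by rw [e01]; exact hb1piece τ); rwa [e01] at h01
    · have h01 := hι₂F 0 _ (by rw [e01]; simpa using hcC1 i); rwa [e01] at h01
  -- bases indexed by `Fin M`: the block basis `cbσ` and the rational basis `eC`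
  set eQ := Module.finBasis ℚ (bettiCohomology (A.prod C).X 1) with heQ
  set eC : Module.Basis (Fin (Module.finrank ℚ (bettiCohomology (A.prod C).X 1))) ℂ
    (ℂ ⊗[ℚ] bettiCohomology (A.prod C).X 1) := Algebra.TensorProduct.basis ℂ eQ with heC
  set φ : Fin (Module.finrank ℚ (bettiCohomology (A.prod C).X 1)) ≃ ({σ : S // deg σ = 1} ⊕ Fin h) × Fin 2 :=
    eC.indexEquiv cbx with hφ
  set cbσ : Module.Basis (Fin (Module.finrank ℚ (bettiCohomology (A.prod C).X 1))) ℂ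
    (ℂ ⊗[ℚ] bettiCohomology (A.prod C).X 1) := cbx.reindex φ.symm with hcbσdef
  have hcbσ : ∀ m, cbσ m = cbx (φ m) := fun m => by rw [hcbσdef, Module.Basis.reindex_apply, Equiv.symm_symm]
  -- letters
  set ρ := ofRatClassBaseChangeEquiv hXP 1 with hρ
  set v : Module.Basis _ ℂ (complexBetti (A.prod C).X 1) := cbσ.map ρ with hv
  set eL : Module.Basis _ ℂ (complexBetti (A.prod C).X 1) := eC.map ρ with heL
  have heLQ : ∀ i, IsRationalClass (eL i) := fun i => by
    rw [heL, Module.Basis.map_apply, heC, Algebra.TensorProduct.basis_apply, hρ, ofRatClassBaseChangeEquiv_apply,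
      ofRatClassBaseChange_tmul, one_smul]; exact isRationalClass_ofRatClass _
  set κ : Fin (Module.finrank ℚ (bettiCohomology (A.prod C).X 1)) → Fin 2 := fun m => (φ m).2 with hκ
  have hv_apply : ∀ m, v m = ofRatClassBaseChange (Motives.ComplexPoints (A.prod C).X) 1 (cbx (φ m)) :=
    fun m => by rw [hv, Module.Basis.map_apply, hcbσ, hρ, ofRatClassBaseChangeEquiv_apply]
  have hv0 : ∀ m, κ m = 0 → IsOfHodgeType (A.prod C).dim (A.prod C).X 1 1 0 (v m) := by
    intro m hm
    rw [hv_apply, ← BettiUniverse.mem_hodge_piece_iff hHD hI hXP (k := 1) (p := 1) (q := 0) rfl,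
      show φ m = ((φ m).1, 0) by change (φ m).2 = 0 at hm; rw [← hm]]
    exact hcbx0 _
  have hv1 : ∀ m, κ m = 1 → IsOfHodgeType (A.prod C).dim (A.prod C).X 1 0 1 (v m) := by
    intro m hm
    rw [hv_apply, ← BettiUniverse.mem_hodge_piece_iff hHD hI hXP (k := 1) (p := 0) (q := 1) rfl,
      show φ m = ((φ m).1, 1) by change (φ m).2 = 1 at hm; rw [← hm]]
    exact hcbx1 _
  -- (α) an antisymmetric kind-balanced coefficient function in the adapted letters
  obtain ⟨ax, hax_bal, hax_anti, hcax⟩ := hg.exists_antisymm_kindBalanced_wordEval_eq v κ hv0 hv1 hp hc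
  -- the change of letters to the rational letters
  set G : Matrix _ _ ℂ := eC.toMatrix cbσ with hG
  set G' : Matrix _ _ ℂ := cbσ.toMatrix eC with hG'
  have hG'G : G' * G = 1 := cbσ.toMatrix_mul_toMatrix_flip eC
  have hve : ∀ m, v m = ∑ i, G i m • eL i := fun m => by
    simp only [hv, heL, Module.Basis.map_apply, ← map_smul, ← map_sum]
    congr 1
    exact (eC.sum_toMatrix_smul_self (v := ⇑cbσ) (j := m)).symm
  have hletters : ∀ j m, avLetters g v (j, m) = ∑ i, G i m • avLetters g eL (j, i) :=
    avLetters_baseChange g G hve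
  set aE := colourChangeAt (fun _ : Fin n => G) ax with haE
  have haE_anti : IsAntisymm aE := hax_anti.colourChangeAt _
  have hcaE : wordEval (cupPowOneAlt ℂ (Motives.ComplexPoints X.X) (2 * p)) (avLetters g eL) aE = c := by
    rw [haE, ← wordEval_eq_wordEval_colourChangeAt _ (fun _ : Fin n => G) hletters ax, hcax]
  -- rationality of `aE`
  obtain ⟨q, hq⟩ := hg.exists_rat_wordEval_eq eL heLQ hcQ
  obtain ⟨q', -, haEq⟩ := haE_anti.exists_eq_algebraMap_of_wordEval_eq
    (injective_alternatingMapLinearEquiv_cupPowOneAlt X (2 * p)) (hg.letterBasis eL) (q := q)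
    (by rw [AVSlots.coe_letterBasis, hcaE, hq])
  have hslice_e : ∀ u, wordSlice aE u = wordRepAt ℂ (fun _ : Fin (2 * p) => G) (wordSlice ax u) :=
    fun u => wordSlice_colourChangeAt (fun _ : Fin n => G) ax u
  -- the Hodge operator `Θ` of `H¹(A × C)`: `diag(±1)` in the adapted letters
  obtain ⟨Θ, hΘ⟩ := exists_hodgeTheta (BettiUniverse.hodge hHD hXP 1)
  have hΘb : ∀ m, Θ (cbσ m) = (if κ m = 0 then (1 : ℂ) else -1) • cbσ m := by
    intro m
    rw [hcbσ]
    change Θ _ = (if (φ m).2 = 0 then (1 : ℂ) else -1) • _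
    rcases Fin.eq_zero_or_eq_succ (φ m).2 with h0 | ⟨j, hj⟩
    · rw [h0, if_pos rfl]
      have hmem : cbx (φ m) ∈ (BettiUniverse.hodge hHD hXP 1).piece 1 (((1 : ℕ) : ℤ) - 1) := by
        rw [show (((1 : ℕ) : ℤ) - 1) = 0 by norm_num, show φ m = ((φ m).1, 0) by rw [← h0]]; exact hcbx0 _
      rw [hΘ 1 _ hmem]; norm_num
    · have h1 : (φ m).2 = 1 := by rw [hj, Fin.eq_zero j]; rfl
      rw [h1, if_neg one_ne_zero]
      have hmem : cbx (φ m) ∈ (BettiUniverse.hodge hHD hXP 1).piece 0 (((1 : ℕ) : ℤ) - 0) := by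
        rw [show (((1 : ℕ) : ℤ) - 0) = 1 by norm_num, show φ m = ((φ m).1, 1) by rw [← h1]]; exact hcbx1 _
      rw [hΘ 0 _ hmem]; norm_num
  have hΘcb : LinearMap.toMatrix cbσ cbσ Θ = kindDiag κ := by
    ext i m
    rw [LinearMap.toMatrix_apply, hΘb, map_smul, Module.Basis.repr_self, Finsupp.smul_apply,
      Finsupp.single_apply, kindDiag, Matrix.diagonal_apply, smul_eq_mul, mul_ite, mul_one, mul_zero]
    by_cases him : i = m
    exacts [by subst him; rw [if_pos rfl], by rw [if_neg (Ne.symm him), if_neg him]]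
  have hJG : LinearMap.toMatrix eC eC Θ * G = G * kindDiag κ := by
    rw [← hΘcb, hG, linearMap_toMatrix_mul_basis_toMatrix, basis_toMatrix_mul_linearMap_toMatrix]
  have hΘq : ∀ u : Fin (2 * p) → Fin n, wordDerAt ℂ (fun _ : Fin (2 * p) => LinearMap.toMatrix eC eC Θ)
      (wordSlice (fun w => algebraMap ℚ ℂ (q' w)) u) = 0 := by
    intro u
    rw [← haEq, hslice_e]
    refine wordDerAt_wordRepAt_eq_zero_of_mul_eq ℂ (fun _ : Fin (2 * p) => G) (fun _ => hJG) ?_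
    rw [wordDerAt_const]
    exact wordDer_kindDiag_wordSlice_eq_zero κ hax_bal u
  -- the CM commutant of `C` and Riemann: the Hodge endomorphisms `s^*`, `s ∈ S`
  obtain ⟨Scm, hScomm, hSF⟩ := IsOfCMType.exists_commutant_comm hC
  set aF₂ : Scm → (BettiUniverse.hodge hHD hXC 1).endAlg := fun s =>
    ⟨MulOpposite.unop (bettiRep C (s : C.endAlgebra)), unop_bettiRep_mem_endAlg hHD hI (s : C.endAlgebra)⟩ with haF₂
  -- the product Lie step, transported to the block letters: for `Y₀ ∈ Lie Hg(A) ⊗ ℂ` acting on the pairs by `M₀`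
  have e11 : ∀ x, π₁.baseChange ℂ (ι₁.baseChange ℂ x) = x := fun x => by
    rw [← LinearMap.comp_apply (f := π₁.baseChange ℂ), hπι₁C, LinearMap.id_apply]
  have e12 : ∀ y, π₁.baseChange ℂ (ι₂.baseChange ℂ y) = 0 := fun y => LinearMap.congr_fun hπ₁ι₂C y
  have hstep : ∀ (Y₀ : Module.End ℂ (ℂ ⊗[ℚ] bettiCohomology A.X 1)) (M₀ : Matrix (Fin 2) (Fin 2) ℂ),
      Y₀ ∈ H.hodgeLieC → (∀ τ r, Y₀ (b (τ, r)) = ∑ r', M₀ r' r • b (τ, r')) →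
      ∀ u : Fin (2 * p) → Fin n, wordDerAt ℂ (fun _ : Fin (2 * p) =>
        blockLift φ (fun t => Sum.elim (fun _ : {σ : S // deg σ = 1} => M₀) (fun _ : Fin h => 0) t)) (wordSlice ax u) = 0 := by
    intro Y₀ M₀ hY₀ hact u
    set Y := ι₁.baseChange ℂ ∘ₗ Y₀ ∘ₗ π₁.baseChange ℂ with hY
    have hL := wordDerAt_eq_zero_of_rankThree_times_abelian rfl (BettiUniverse.hodge hHD hXP 1) H
      (BettiUniverse.hodge hHD hXC 1) hπι₁ hπι₂ hπ₁ι₂ hπ₂ι₁ hsum hι₁F hι₂F ψ hH hne h3 aF₂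
      (fun Y Y' hY hY' => hSF Y Y' (fun s => hY s) (fun s => hY' s)) eQ q' hΘ hΘq hY₀ u
    rw [← haEq, hslice_e] at hL
    have hYG : ∀ _t : Fin (2 * p), LinearMap.toMatrix eC eC Y * G = G * LinearMap.toMatrix cbσ cbσ Y :=
      fun _ => by rw [hG, linearMap_toMatrix_mul_basis_toMatrix, basis_toMatrix_mul_linearMap_toMatrix]
    have hblk : LinearMap.toMatrix cbσ cbσ Y = blockLift φ (fun t => Sum.elim (fun _ : {σ : S // deg σ = 1} => M₀) (fun _ : Fin h => 0) t) := by
      refine toMatrix_eq_blockLift_of_apply_basis φ cbσ _ Y fun m => ?_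
      rw [hcbσ m]
      have hb' : ∀ a, cbσ (φ.symm ((φ m).1, a)) = cbx ((φ m).1, a) := fun a => by
        rw [hcbσ, Equiv.apply_symm_apply]
      simp only [hb']
      obtain ⟨t, r⟩ := φ m
      rcases t with τ | i
      · simp only [hcbx, Sum.elim_inl]
        rw [hY, LinearMap.comp_apply, LinearMap.comp_apply, e11, hact, map_sum]
        exact Finset.sum_congr rfl fun a _ => by rw [map_smul]
      · simp only [hcbx, Sum.elim_inr]
        rw [hY, LinearMap.comp_apply, LinearMap.comp_apply, e12, map_zero, map_zero]
        exact (Finset.sum_eq_zero fun a _ => by rw [Matrix.zero_apply, zero_smul]).symm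
    have h3' : wordRepAt ℂ (fun _ : Fin (2 * p) => G) (wordDerAt ℂ (fun _ : Fin (2 * p) =>
        blockLift φ (fun t => Sum.elim (fun _ : {σ : S // deg σ = 1} => M₀) (fun _ : Fin h => 0) t)) (wordSlice ax u)) = 0 := by
      rw [← hblk, wordRepAt_wordDerAt_of_mul_eq ℂ (fun _ : Fin (2 * p) => G) hYG, hL]
    exact wordRepAt_injective ℂ (g := fun _ : Fin (2 * p) => G) (g' := fun _ : Fin (2 * p) => G')
      (funext fun _ => hG'G) (by rw [h3', map_zero])
  -- the refined coefficient function
  refine ⟨placeRefine φ ax, ?_, fun U => ?_⟩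
  · rw [← hcax]
    have hx : (fun jr : (Fin n × ({σ : S // deg σ = 1} ⊕ Fin h)) × Fin 2 => avLetters g v (jr.1.1, φ.symm (jr.1.2, jr.2))) =
        fun jr : (Fin n × ({σ : S // deg σ = 1} ⊕ Fin h)) × Fin 2 => complexBetti.map (g jr.1.1).hom.hom.hom 1
          (Sum.elim
            (fun τ => complexBetti.map (Motives.AbelianVariety.fst A C).hom.hom.hom 1
              (ofRatClassBaseChange (Motives.ComplexPoints A.X) 1 (b (τ, jr.2))))
            (fun i => complexBetti.map (Motives.AbelianVariety.snd A C).hom.hom.hom 1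
              (ofRatClassBaseChange (Motives.ComplexPoints C.X) 1 (cC (i, jr.2))))
            jr.1.2) := by
      funext jr
      rw [avLetters_apply, hv_apply, Equiv.apply_symm_apply, hcbx]
      obtain ⟨⟨j, t⟩, r⟩ := jr
      rcases t with τ | i
      · simp only [Sum.elim_inl]
        congr 1
        rw [hι₁, ← ofRatClassBaseChangeEquiv_apply (hX := hXP), ← ofRatClassBaseChangeEquiv_apply (hX := hXA),
          complexBetti_map_ofRatClassBaseChangeEquiv hXP hXA]
      · simp only [Sum.elim_inr]
        congr 1
        rw [hι₂, ← ofRatClassBaseChangeEquiv_apply (hX := hXP), ← ofRatClassBaseChangeEquiv_apply (hX := hXC),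
          complexBetti_map_ofRatClassBaseChangeEquiv hXP hXC]
    rw [← hx]
    exact wordEval_placeRefine _ φ (avLetters g v) ax
  · -- the generators `α E₀₁` (rescaled by `α⁻¹`) and `diag(1,-1)` kill the refined slices, placed at all `A`-positions
    have hgen : ∀ (Y₀ : Module.End ℂ (ℂ ⊗[ℚ] bettiCohomology A.X 1)) (M₀ : Matrix (Fin 2) (Fin 2) ℂ),
        Y₀ ∈ H.hodgeLieC → (∀ τ r, Y₀ (b (τ, r)) = ∑ r', M₀ r' r • b (τ, r')) →
        wordDerAt ℂ (fun t => Sum.elim (fun _ : {σ : S // deg σ = 1} => M₀) (fun _ : Fin h => 0) (U t).2)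
          (wordSlice (placeRefine φ ax) U) = 0 :=
      fun Y₀ M₀ hY₀ hact => wordDerAt_placeFamily_placeRefine_eq_zero φ
        (fun t => Sum.elim (fun _ : {σ : S // deg σ = 1} => M₀) (fun _ : Fin h => 0) t) (hstep Y₀ M₀ hY₀ hact) U
    refine ⟨?_, hgen Θ' _ hΘ'M hΘ'b⟩
    have hE := hgen E (α • Matrix.single 0 1 (1 : ℂ)) hEM hEb
    have hfam : (fun t => Sum.elim (fun _ : {σ : S // deg σ = 1} => α • Matrix.single 0 1 (1 : ℂ))
        (fun _ : Fin h => (0 : Matrix (Fin 2) (Fin 2) ℂ)) (U t).2) =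
        α • fun t => Sum.elim (fun _ : {σ : S // deg σ = 1} => Matrix.single 0 1 (1 : ℂ))
          (fun _ : Fin h => (0 : Matrix (Fin 2) (Fin 2) ℂ)) (U t).2 := by
      funext t
      simp only [Pi.smul_apply]
      rcases (U t).2 with τ | i
      · simp
      · simp
    rw [hfam, wordDerAt_smul] at hE
    exact (smul_eq_zero.1 hE).resolve_left hα

end Invariance

end Literature.AlgebraicGeometry.HodgeTheory

end
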